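import Literature.NumberTheory.EllipticCurves.SelmerCorankProofs
import HarnessLib

/-!
# Crux U1 `KolyvaginBoundedDefectAtTwo` (stmt-BirchSwinnertonDyer-28083), LINE 17 `regular_core_rigidity`,
# toward the START FRAME (N3‴) — the start eigenframe of a `2`-divisible `τ`-stable subgroup, WITH THE RANK COUNT

Width seat `bsd-line-krr2-p2` g16 (ONE READER on S1b), landing the pen's (`bsd-idea-1` g12, HOME
`line17/EigenframeFiniteLevel.lean` v2, sha16 4238f1c9b5931cfd) finite-level eigenframe algebra, re-cut to the part the
start-frame assembly consumes and extended by the COUNT of the bottom layers (`#((1±τ)C ∩ A[2]) = 2^{r_±}`);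
`--supports stmt-BirchSwinnertonDyer-28083` (helper). THEOREMS ONLY, pure algebra (an additive commutative group `A`, an additive
involution `τ`, integer coefficients — the tree's currency for `Sel_{2^∞}(E/K)`); nothing here proves the start frame, S1b, U1,
a rung or BSD. BSD is NOT proved.

* `lossOne_finite` — LOSS-ONE independence of a `τ`-fixed `ℤ/2^k`-free family joint with a `τ`-antifixed one;
* `free_of_bot_layer` / `mem_span_of_bot_layer_of_mem` / `exists_lift_of_two_divisible` — an `𝔽₂`-basis of the bottom layer of a
  `2`-divisible subgroup lifts to a `ℤ/2^k`-free generating family of its `2^k`-torsion (homocyclicity without a structure theorem);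
* `exists_bot_basis` — an `𝔽₂`-basis (integer form) of `B ∩ A[2]` from finiteness, of size `n` with **`#(B ∩ A[2]) = 2^n`**;
* `eigenframe_of_divisible` — for `C ≤ A` `τ`-stable and `2`-divisible and bases of the bottom layers of `C_± = (1 ± τ)C`: at every
  level `k ≥ 1` lifts `e ⊆ C₊[2^k]`, `f ⊆ C₋[2^k]` (eigen-signs `±1`, exact order `2^k`, each part `ℤ/2^k`-free, joint LOSS ONE,
  `2·C[2^k] ⊆ span(e, f)`);
* `eigenframe_of_divisible_finite_card` — the same from `A[2]` finite alone, with level-free ranks `r₊, r₋` AND the counts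
  `#(C₊ ∩ A[2]) = 2^{r₊}`, `#(C₋ ∩ A[2]) = 2^{r₋}` (so `r₊ + r₋ = dim C[2]` by `EigenframeFinite.natCard_inf_torsionBy_two_eq_mul_of_involution`).
[cite: Greenberg1999, §1–2 (cofinitely generated `ℤ_p`-modules)] [folklore]
Design: no definitions; axioms `propext`, `Classical.choice`, `Quot.sound`.
-/

set_option autoImplicit false
-- the Theorems namespace of this sub repeats the summit name by design (D-0017 nested layout)
set_option linter.dupNamespace false

open Literature.NumberTheory.EllipticCurves

namespace Summit.BirchSwinnertonDyer.BirchSwinnertonDyer.Theorems.KolyvaginAtTwo.EigenframeFinite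

variable {A : Type*} [AddCommGroup A]

/-- A class that is both `τ`-fixed and `τ`-antifixed is killed by `2`. [folklore] -/
theorem two_smul_eq_zero_of_fixed_of_antifixed (τ : A →+ A) {u : A} (hp : τ u = u) (hm : τ u = -u) :
    (2 : ℤ) • u = 0 := by
  rw [two_smul]
  nth_rewrite 2 [← hp]
  rw [hm, add_neg_cancel]

/-- Symmetrisation is `τ`-fixed, antisymmetrisation is `τ`-antifixed, and they add up to `2a`. [folklore] -/
theorem symm_antisymm (τ : A →+ A) (hτ : ∀ a, τ (τ a) = a) (a : A) :
    τ (a + τ a) = a + τ a ∧ τ (a - τ a) = -(a - τ a) ∧ (2 : ℤ) • a = (a + τ a) + (a - τ a) := by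
  refine ⟨?_, ?_, ?_⟩
  · rw [map_add, hτ, add_comm]
  · rw [map_sub, hτ, neg_sub]
  · rw [two_smul]; abel

/-- **Loss-one freeness at finite level.** `e` a `τ`-fixed family free over `ℤ/2^k`, `f` a `τ`-antifixed family free over
`ℤ/2^k` (`k ≥ 1`); then `∑ aᵢeᵢ + ∑ bⱼfⱼ = 0` forces `2^(k-1) ∣ aᵢ` and `2^(k-1) ∣ bⱼ` (`u = ∑ aᵢeᵢ = -∑ bⱼfⱼ` is fixed and
antifixed, so `2u = 0`, so `2^k ∣ 2aᵢ`). Sharp: `ℤ/2^k[C₂] ∋ 1 = ((1+τ) + (1−τ))/2`. [folklore] -/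
theorem lossOne_finite {ι κ : Type*} [Fintype ι] [Fintype κ] (τ : A →+ A)
    (e : ι → A) (f : κ → A) (he : ∀ i, τ (e i) = e i) (hf : ∀ j, τ (f j) = -f j) (k : ℕ) (hk : 1 ≤ k)
    (heI : ∀ a : ι → ℤ, ∑ i, a i • e i = 0 → ∀ i, (2 : ℤ) ^ k ∣ a i)
    (hfI : ∀ b : κ → ℤ, ∑ j, b j • f j = 0 → ∀ j, (2 : ℤ) ^ k ∣ b j)
    (a : ι → ℤ) (b : κ → ℤ) (h : ∑ i, a i • e i + ∑ j, b j • f j = 0) :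
    (∀ i, (2 : ℤ) ^ (k - 1) ∣ a i) ∧ (∀ j, (2 : ℤ) ^ (k - 1) ∣ b j) := by
  have h2k : (2 : ℤ) ^ k = 2 * 2 ^ (k - 1) := by
    rw [← pow_succ', Nat.sub_add_cancel hk]
  have hu : τ (∑ i, a i • e i) = ∑ i, a i • e i := by
    rw [map_sum]; simp only [map_zsmul, he]
  have hw : τ (∑ j, b j • f j) = -∑ j, b j • f j := by
    rw [map_sum]; simp only [map_zsmul, hf, smul_neg, Finset.sum_neg_distrib]
  have huw : ∑ i, a i • e i = -∑ j, b j • f j := eq_neg_of_add_eq_zero_left h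
  have hu' : τ (∑ i, a i • e i) = -∑ i, a i • e i := by rw [huw, map_neg, hw]
  have hw' : τ (∑ j, b j • f j) = ∑ j, b j • f j := by
    have : ∑ j, b j • f j = -∑ i, a i • e i := by rw [huw, neg_neg]
    rw [this, map_neg, hu]
  have h2u := two_smul_eq_zero_of_fixed_of_antifixed τ hu hu'
  have h2w := two_smul_eq_zero_of_fixed_of_antifixed τ hw' hw
  rw [Finset.smul_sum] at h2u h2w
  simp only [smul_smul] at h2u h2w
  constructor
  · intro i
    have hi := heI (fun i ↦ 2 * a i) h2u i
    rw [h2k] at hi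
    exact (mul_dvd_mul_iff_left two_ne_zero).1 hi
  · intro j
    have hj := hfI (fun j ↦ 2 * b j) h2w j
    rw [h2k] at hj
    exact (mul_dvd_mul_iff_left two_ne_zero).1 hj

/-! ## Homocyclic bases of `D[2^k]` from an `𝔽₂`-basis of `D[2]` -/

section Homocyclic

variable {ι : Type*} [Fintype ι]

/-- FREENESS LIFT: if the bottom layer `(2^(k-1) gᵢ)` is `𝔽₂`-independent, the family `g` is free over `ℤ/2^k`:
`∑ aᵢ gᵢ = 0 ⇒ 2^k ∣ aᵢ` (induction on the `2`-adic valuation of the coefficients). [folklore] -/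
theorem free_of_bot_layer (g : ι → A) (k : ℕ)
    (hB1 : ∀ ε : ι → ℤ, ∑ i, (ε i * 2 ^ (k - 1)) • g i = 0 → ∀ i, (2 : ℤ) ∣ ε i)
    (a : ι → ℤ) (h : ∑ i, a i • g i = 0) : ∀ i, (2 : ℤ) ^ k ∣ a i := by
  suffices H : ∀ m, m ≤ k → ∀ i, (2 : ℤ) ^ m ∣ a i from H k le_rfl
  intro m
  induction m with
  | zero => intro _ i; simp
  | succ m ih =>
    intro hm
    have hmk : m < k := hm
    choose b hb using ih hmk.le
    have hrel : ∑ i, (b i * 2 ^ (k - 1)) • g i = 0 := by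
      set d : ℕ := k - 1 - m with hd
      have hkm : k - 1 = d + m := by omega
      have : ((2 : ℤ) ^ d) • ∑ i, a i • g i = 0 := by rw [h, smul_zero]
      rw [Finset.smul_sum] at this
      simp only [smul_smul] at this
      rw [hkm, ← this]
      refine Finset.sum_congr rfl fun i _ ↦ ?_
      rw [hb i, pow_add]
      congr 1
      ring
    intro i
    obtain ⟨c, hc⟩ := hB1 b hrel i
    refine ⟨c, ?_⟩
    rw [hb i, hc, pow_succ]
    ring

/-- GENERATION LIFT relative to a subgroup `B` containing the family: if the bottom layer `(2^(k-1) gᵢ)` spans `B[2]`, the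
family `g` spans `B[2^k]` (induction on the order). [folklore] -/
theorem mem_span_of_bot_layer_of_mem (B : AddSubgroup A) (g : ι → A) (hg : ∀ i, g i ∈ B) (k : ℕ)
    (hB2 : ∀ t ∈ B, (2 : ℤ) • t = 0 → ∃ ε : ι → ℤ, t = ∑ i, (ε i * 2 ^ (k - 1)) • g i)
    (t : A) (htB : t ∈ B) (ht : (2 : ℤ) ^ k • t = 0) : ∃ a : ι → ℤ, t = ∑ i, a i • g i := by
  suffices H : ∀ j, j ≤ k → ∀ t ∈ B, (2 : ℤ) ^ j • t = 0 → ∃ a : ι → ℤ, t = ∑ i, a i • g i from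
    H k le_rfl t htB ht
  intro j
  induction j with
  | zero =>
    intro _ t _ ht
    refine ⟨fun _ ↦ 0, ?_⟩
    simpa using ht
  | succ j ih =>
    intro hj t htB ht
    have hjk : j < k := hj
    have h2 : (2 : ℤ) • ((2 : ℤ) ^ j • t) = 0 := by rw [smul_smul, ← pow_succ', ht]
    obtain ⟨ε, hε⟩ := hB2 _ (B.zsmul_mem htB _) h2
    set d : ℕ := k - 1 - j with hd
    have hkj : k - 1 = d + j := by omega
    set t' : A := t - ∑ i, (ε i * 2 ^ d) • g i with ht'def
    have ht'B : t' ∈ B := B.sub_mem htB (B.sum_mem fun i _ ↦ B.zsmul_mem (hg i) _)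
    have ht' : (2 : ℤ) ^ j • t' = 0 := by
      rw [ht'def, smul_sub, Finset.smul_sum, sub_eq_zero, hε, hkj]
      refine Finset.sum_congr rfl fun i _ ↦ ?_
      rw [smul_smul, pow_add]
      congr 1
      ring
    obtain ⟨a', ha'⟩ := ih hjk.le t' ht'B ht'
    refine ⟨fun i ↦ a' i + ε i * 2 ^ d, ?_⟩
    have : t = t' + ∑ i, (ε i * 2 ^ d) • g i := by rw [ht'def, sub_add_cancel]
    rw [this, ha', ← Finset.sum_add_distrib]
    refine Finset.sum_congr rfl fun i _ ↦ ?_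
    rw [add_smul]

/-- LIFTING THE BOTTOM LAYER through a `2`-divisible subgroup: `t ∈ C` with `2t = 0` is `2^(k-1) s` for some `s ∈ C` with
`2^k s = 0` (`k ≥ 1`). [folklore] -/
theorem exists_lift_of_two_divisible (C : AddSubgroup A) (hdiv : ∀ c ∈ C, ∃ c' ∈ C, (2 : ℤ) • c' = c)
    (k : ℕ) (hk : 1 ≤ k) {t : A} (ht : t ∈ C) (h2 : (2 : ℤ) • t = 0) :
    ∃ s ∈ C, (2 : ℤ) ^ (k - 1) • s = t ∧ (2 : ℤ) ^ k • s = 0 := by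
  induction k, hk using Nat.le_induction with
  | base => exact ⟨t, ht, by simp, by simpa using h2⟩
  | succ k hk ih =>
    obtain ⟨s, hs, hks, hk0⟩ := ih
    obtain ⟨s', hs', h2s'⟩ := hdiv s hs
    refine ⟨s', hs', ?_, ?_⟩
    · rw [show k + 1 - 1 = (k - 1) + 1 from by omega, pow_succ, mul_smul, h2s', hks]
    · rw [pow_succ, mul_smul, h2s', hk0]

end Homocyclic

/-! ## The start eigenframe of a `2`-divisible `τ`-stable subgroup -/

section StartFrame

/-- Membership in the symmetrised part `(1+τ)C = C.map (id + τ)`. [folklore] -/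
theorem mem_map_id_add (τ : A →+ A) (C : AddSubgroup A) (t : A) :
    t ∈ C.map (AddMonoidHom.id A + τ) ↔ ∃ c ∈ C, t = c + τ c := by
  simp only [AddSubgroup.mem_map, AddMonoidHom.add_apply, AddMonoidHom.id_apply]
  exact ⟨fun ⟨c, hc, h⟩ ↦ ⟨c, hc, h.symm⟩, fun ⟨c, hc, h⟩ ↦ ⟨c, hc, h.symm⟩⟩

/-- Membership in the antisymmetrised part `(1-τ)C = C.map (id - τ)`. [folklore] -/
theorem mem_map_id_sub (τ : A →+ A) (C : AddSubgroup A) (t : A) :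
    t ∈ C.map (AddMonoidHom.id A - τ) ↔ ∃ c ∈ C, t = c - τ c := by
  simp only [AddSubgroup.mem_map, AddMonoidHom.sub_apply, AddMonoidHom.id_apply]
  exact ⟨fun ⟨c, hc, h⟩ ↦ ⟨c, hc, h.symm⟩, fun ⟨c, hc, h⟩ ↦ ⟨c, hc, h.symm⟩⟩

/-- **THE START EIGENFRAME of a `2`-divisible `τ`-stable subgroup** (all levels `k ≥ 1` at once): `C ≤ A` `τ`-stable and
`2`-divisible; `p` an `𝔽₂`-basis (integer form) of the bottom layer of `C₊ := (1+τ)C` and `m` one of `C₋ := (1−τ)C`. Then for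
every `k ≥ 1` there are lifts `e ⊆ C₊[2^k]`, `f ⊆ C₋[2^k]` (`τ`-fixed / `τ`-antifixed, each free over `ℤ/2^k`, of exact order
`2^k`) such that the joint frame `(e, f)` is independent with LOSS ONE and `2 · C[2^k] ⊆ span(e, f)`. [folklore] -/
theorem eigenframe_of_divisible {ι κ : Type*} [Fintype ι] [Fintype κ] [DecidableEq ι] [DecidableEq κ]
    (τ : A →+ A) (hτ : ∀ a, τ (τ a) = a)
    (C : AddSubgroup A) (hC : ∀ c ∈ C, τ c ∈ C) (hdiv : ∀ c ∈ C, ∃ c' ∈ C, (2 : ℤ) • c' = c)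
    (p : ι → A) (hpC : ∀ i, ∃ c ∈ C, p i = c + τ c) (hp2 : ∀ i, (2 : ℤ) • p i = 0)
    (hpI : ∀ ε : ι → ℤ, ∑ i, ε i • p i = 0 → ∀ i, (2 : ℤ) ∣ ε i)
    (hpS : ∀ t : A, (∃ c ∈ C, t = c + τ c) → (2 : ℤ) • t = 0 → ∃ ε : ι → ℤ, t = ∑ i, ε i • p i)
    (m : κ → A) (hmC : ∀ j, ∃ c ∈ C, m j = c - τ c) (hm2 : ∀ j, (2 : ℤ) • m j = 0)
    (hmI : ∀ ε : κ → ℤ, ∑ j, ε j • m j = 0 → ∀ j, (2 : ℤ) ∣ ε j)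
    (hmS : ∀ t : A, (∃ c ∈ C, t = c - τ c) → (2 : ℤ) • t = 0 → ∃ ε : κ → ℤ, t = ∑ j, ε j • m j)
    (k : ℕ) (hk : 1 ≤ k) :
    ∃ (e : ι → A) (f : κ → A),
      (∀ i, e i ∈ C) ∧ (∀ j, f j ∈ C) ∧ (∀ i, τ (e i) = e i) ∧ (∀ j, τ (f j) = -f j) ∧
      (∀ i, (2 : ℤ) ^ k • e i = 0) ∧ (∀ j, (2 : ℤ) ^ k • f j = 0) ∧
      (∀ i, (2 : ℤ) ^ (k - 1) • e i ≠ 0) ∧ (∀ j, (2 : ℤ) ^ (k - 1) • f j ≠ 0) ∧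
      (∀ a : ι → ℤ, ∑ i, a i • e i = 0 → ∀ i, (2 : ℤ) ^ k ∣ a i) ∧
      (∀ b : κ → ℤ, ∑ j, b j • f j = 0 → ∀ j, (2 : ℤ) ^ k ∣ b j) ∧
      (∀ (a : ι → ℤ) (b : κ → ℤ), ∑ i, a i • e i + ∑ j, b j • f j = 0 →
        (∀ i, (2 : ℤ) ^ (k - 1) ∣ a i) ∧ (∀ j, (2 : ℤ) ^ (k - 1) ∣ b j)) ∧
      (∀ c ∈ C, (2 : ℤ) ^ k • c = 0 →
        ∃ (a : ι → ℤ) (b : κ → ℤ), (2 : ℤ) • c = ∑ i, a i • e i + ∑ j, b j • f j) := by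
  set Bp : AddSubgroup A := C.map (AddMonoidHom.id A + τ) with hBp
  set Bm : AddSubgroup A := C.map (AddMonoidHom.id A - τ) with hBm
  have memBp : ∀ t, t ∈ Bp ↔ ∃ c ∈ C, t = c + τ c := fun t ↦ mem_map_id_add τ C t
  have memBm : ∀ t, t ∈ Bm ↔ ∃ c ∈ C, t = c - τ c := fun t ↦ mem_map_id_sub τ C t
  have BpC : ∀ t ∈ Bp, t ∈ C := fun t ht ↦ by
    obtain ⟨c, hc, rfl⟩ := (memBp t).1 ht; exact C.add_mem hc (hC c hc)
  have BmC : ∀ t ∈ Bm, t ∈ C := fun t ht ↦ by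
    obtain ⟨c, hc, rfl⟩ := (memBm t).1 ht; exact C.sub_mem hc (hC c hc)
  have Bpfix : ∀ t ∈ Bp, τ t = t := fun t ht ↦ by
    obtain ⟨c, hc, rfl⟩ := (memBp t).1 ht; exact (symm_antisymm τ hτ c).1
  have Bmanti : ∀ t ∈ Bm, τ t = -t := fun t ht ↦ by
    obtain ⟨c, hc, rfl⟩ := (memBm t).1 ht; exact (symm_antisymm τ hτ c).2.1
  have Bpdiv : ∀ t ∈ Bp, ∃ t' ∈ Bp, (2 : ℤ) • t' = t := fun t ht ↦ by
    obtain ⟨c, hc, rfl⟩ := (memBp t).1 ht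
    obtain ⟨c', hc', h2⟩ := hdiv c hc
    refine ⟨c' + τ c', (memBp _).2 ⟨c', hc', rfl⟩, ?_⟩
    rw [smul_add, ← map_zsmul, h2]
  have Bmdiv : ∀ t ∈ Bm, ∃ t' ∈ Bm, (2 : ℤ) • t' = t := fun t ht ↦ by
    obtain ⟨c, hc, rfl⟩ := (memBm t).1 ht
    obtain ⟨c', hc', h2⟩ := hdiv c hc
    refine ⟨c' - τ c', (memBm _).2 ⟨c', hc', rfl⟩, ?_⟩
    rw [smul_sub, ← map_zsmul, h2]
  have hpB : ∀ i, p i ∈ Bp := fun i ↦ (memBp _).2 (hpC i)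
  have hmB : ∀ j, m j ∈ Bm := fun j ↦ (memBm _).2 (hmC j)
  choose e heB hep hek using fun i ↦ exists_lift_of_two_divisible Bp Bpdiv k hk (hpB i) (hp2 i)
  choose f hfB hfm hfk using fun j ↦ exists_lift_of_two_divisible Bm Bmdiv k hk (hmB j) (hm2 j)
  have he : ∀ i, τ (e i) = e i := fun i ↦ Bpfix _ (heB i)
  have hf : ∀ j, τ (f j) = -f j := fun j ↦ Bmanti _ (hfB j)
  have hp0 : ∀ i, p i ≠ 0 := fun i h0 ↦ by
    have := hpI (Pi.single i 1) (by simp [Pi.single_apply, h0]) i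
    simp at this
  have hm0 : ∀ j, m j ≠ 0 := fun j h0 ↦ by
    have := hmI (Pi.single j 1) (by simp [Pi.single_apply, h0]) j
    simp at this
  have heI : ∀ a : ι → ℤ, ∑ i, a i • e i = 0 → ∀ i, (2 : ℤ) ^ k ∣ a i :=
    free_of_bot_layer e k fun ε hε ↦ hpI ε (by
      rw [← hε]; exact Finset.sum_congr rfl fun i _ ↦ by rw [mul_smul, hep])
  have hfI : ∀ b : κ → ℤ, ∑ j, b j • f j = 0 → ∀ j, (2 : ℤ) ^ k ∣ b j :=
    free_of_bot_layer f k fun ε hε ↦ hmI ε (by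
      rw [← hε]; exact Finset.sum_congr rfl fun j _ ↦ by rw [mul_smul, hfm])
  have heS : ∀ t ∈ Bp, (2 : ℤ) ^ k • t = 0 → ∃ a : ι → ℤ, t = ∑ i, a i • e i :=
    fun t htB ht ↦ mem_span_of_bot_layer_of_mem Bp e heB k (fun t htB h2 ↦ by
      obtain ⟨ε, hε⟩ := hpS t ((memBp t).1 htB) h2
      exact ⟨ε, by rw [hε]; exact Finset.sum_congr rfl fun i _ ↦ by rw [mul_smul, hep]⟩) t htB ht
  have hfS : ∀ t ∈ Bm, (2 : ℤ) ^ k • t = 0 → ∃ b : κ → ℤ, t = ∑ j, b j • f j :=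
    fun t htB ht ↦ mem_span_of_bot_layer_of_mem Bm f hfB k (fun t htB h2 ↦ by
      obtain ⟨ε, hε⟩ := hmS t ((memBm t).1 htB) h2
      exact ⟨ε, by rw [hε]; exact Finset.sum_congr rfl fun j _ ↦ by rw [mul_smul, hfm]⟩) t htB ht
  refine ⟨e, f, fun i ↦ BpC _ (heB i), fun j ↦ BmC _ (hfB j), he, hf, hek, hfk,
    fun i ↦ by rw [hep]; exact hp0 i, fun j ↦ by rw [hfm]; exact hm0 j, heI, hfI,
    fun a b h ↦ lossOne_finite τ e f he hf k hk heI hfI a b h, ?_⟩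
  intro c hc hck
  obtain ⟨hp', hm', h2c⟩ := symm_antisymm τ hτ c
  have huB : c + τ c ∈ Bp := (memBp _).2 ⟨c, hc, rfl⟩
  have hvB : c - τ c ∈ Bm := (memBm _).2 ⟨c, hc, rfl⟩
  have hτk : (2 : ℤ) ^ k • τ c = 0 := by rw [← map_zsmul, hck, map_zero]
  obtain ⟨a, ha⟩ := heS _ huB (by rw [smul_add, hck, hτk, add_zero])
  obtain ⟨b, hb⟩ := hfS _ hvB (by rw [smul_sub, hck, hτk, sub_zero])
  exact ⟨a, b, by rw [h2c, ha, hb]⟩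

end StartFrame

/-! ## Bases of the bottom layers from finiteness, with their count; the frame from `A[2]` finite alone -/

section Finite

open AddSubgroup in
/-- An `𝔽₂`-BASIS (integer form) of the bottom layer `B ∩ A[2]` of a subgroup `B`, from its finiteness (`Module.finBasis` over
`ZMod 2`), of size `n` with **`#(B ∩ A[2]) = 2^n`**. [folklore] -/
theorem exists_bot_basis (B : AddSubgroup A) [hfin : Finite ↥(B ⊓ torsionBy A ((2 : ℕ) : ℤ))] :
    ∃ (n : ℕ) (p : Fin n → A), Nat.card ↥(B ⊓ torsionBy A ((2 : ℕ) : ℤ)) = 2 ^ n ∧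
      (∀ i, p i ∈ B) ∧ (∀ i, (2 : ℤ) • p i = 0) ∧
      (∀ ε : Fin n → ℤ, ∑ i, ε i • p i = 0 → ∀ i, (2 : ℤ) ∣ ε i) ∧
      (∀ t ∈ B, (2 : ℤ) • t = 0 → ∃ ε : Fin n → ℤ, t = ∑ i, ε i • p i) := by
  classical
  haveI : Fact (Nat.Prime 2) := ⟨Nat.prime_two⟩
  set V : AddSubgroup A := B ⊓ torsionBy A ((2 : ℕ) : ℤ) with hV
  have memV : ∀ t, t ∈ V ↔ t ∈ B ∧ (2 : ℤ) • t = 0 := fun t ↦ by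
    rw [hV, mem_inf, torsionBy, Submodule.mem_toAddSubgroup, Submodule.mem_torsionBy_iff, Nat.cast_ofNat]
  have hV2 : ∀ x : V, (2 : ℕ) • x = 0 := fun x ↦ by
    apply Subtype.ext
    have hx := ((memV x.1).1 x.2).2
    rw [AddSubmonoidClass.coe_nsmul, ← ofNat_zsmul]
    exact hx
  letI : Module (ZMod 2) V := AddCommGroup.zmodModule hV2
  set n : ℕ := Module.finrank (ZMod 2) V with hn
  let bV := Module.finBasis (ZMod 2) V
  have key : ∀ (z : ℤ) (i : Fin n), (((z : ZMod 2) • bV i : V) : A) = z • (bV i : A) := fun z i ↦ by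
    rw [← AddSubgroupClass.coe_zsmul, ← Int.cast_smul_eq_zsmul (ZMod 2)]
  refine ⟨n, fun i ↦ (bV i : A), (pow_finrank_eq_natCard (p := 2) V).symm, fun i ↦ ((memV _).1 (bV i).2).1,
    fun i ↦ ((memV _).1 (bV i).2).2, ?_, ?_⟩
  · intro ε hε i
    have hsum : ∑ i, ((ε i : ℤ) : ZMod 2) • bV i = 0 := by
      apply Subtype.ext
      rw [AddSubmonoidClass.coe_finsetSum, ZeroMemClass.coe_zero, ← hε]
      exact Finset.sum_congr rfl fun i _ ↦ key (ε i) i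
    have hli := (Fintype.linearIndependent_iff.1 bV.linearIndependent) (fun i ↦ ((ε i : ℤ) : ZMod 2)) hsum i
    have := (ZMod.intCast_zmod_eq_zero_iff_dvd (ε i) 2).1 hli
    simpa using this
  · intro t htB ht2
    set v : V := ⟨t, (memV t).2 ⟨htB, ht2⟩⟩ with hv
    refine ⟨fun i ↦ ((bV.repr v i).val : ℤ), ?_⟩
    have hrepr := bV.sum_repr v
    have hcast : ∀ i, ((((bV.repr v i).val : ℤ)) : ZMod 2) = bV.repr v i := fun i ↦ by
      rw [Int.cast_natCast, ZMod.natCast_zmod_val]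
    calc t = (v : A) := rfl
      _ = ((∑ i, bV.repr v i • bV i : V) : A) := by rw [hrepr]
      _ = ∑ i, ((bV.repr v i).val : ℤ) • (bV i : A) := by
          rw [AddSubmonoidClass.coe_finsetSum]
          refine Finset.sum_congr rfl fun i _ ↦ ?_
          rw [← key, hcast]

open AddSubgroup in
/-- **THE START EIGENFRAME from `A[2]` finite, WITH THE RANK COUNT.** `τ` an involution of `A` with `A[2]` finite, `C ≤ A`
`τ`-stable and `2`-divisible. Then there are LEVEL-FREE ranks `r₊ r₋` with `#((1+τ)C ∩ A[2]) = 2^{r₊}`, `#((1−τ)C ∩ A[2]) = 2^{r₋}`,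
and for every `k ≥ 1` `Fin`-indexed frames `e ⊆ C₊[2^k]`, `f ⊆ C₋[2^k]` with every property of `eigenframe_of_divisible`
(eigen-signs, torsion `2^k`, exact order, each part free over `ℤ/2^k`, joint LOSS-ONE independence, `2·C[2^k] ⊆ span`).
With `A = Sel_{2^∞}(E/K)`, `C` its maximal divisible subgroup and `τ` complex conjugation this is the algebra of the start frame;
`r₊ + r₋ = dim C[2]` by `natCard_inf_torsionBy_two_eq_mul_of_involution`. [cite: Greenberg1999, §1–2] [folklore] -/
theorem eigenframe_of_divisible_finite_card (τ : A →+ A) (hτ : ∀ a, τ (τ a) = a)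
    (C : AddSubgroup A) (hC : ∀ c ∈ C, τ c ∈ C) (hdiv : ∀ c ∈ C, ∃ c' ∈ C, (2 : ℤ) • c' = c)
    [hfin : Finite ↥(torsionBy A ((2 : ℕ) : ℤ))] :
    ∃ rp rm : ℕ, Nat.card ↥(C.map (AddMonoidHom.id A + τ) ⊓ torsionBy A ((2 : ℕ) : ℤ)) = 2 ^ rp ∧
      Nat.card ↥(C.map (AddMonoidHom.id A - τ) ⊓ torsionBy A ((2 : ℕ) : ℤ)) = 2 ^ rm ∧
    ∀ k : ℕ, 1 ≤ k →
    ∃ (e : Fin rp → A) (f : Fin rm → A),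
      (∀ i, e i ∈ C) ∧ (∀ j, f j ∈ C) ∧ (∀ i, τ (e i) = e i) ∧ (∀ j, τ (f j) = -f j) ∧
      (∀ i, (2 : ℤ) ^ k • e i = 0) ∧ (∀ j, (2 : ℤ) ^ k • f j = 0) ∧
      (∀ i, (2 : ℤ) ^ (k - 1) • e i ≠ 0) ∧ (∀ j, (2 : ℤ) ^ (k - 1) • f j ≠ 0) ∧
      (∀ a : Fin rp → ℤ, ∑ i, a i • e i = 0 → ∀ i, (2 : ℤ) ^ k ∣ a i) ∧
      (∀ b : Fin rm → ℤ, ∑ j, b j • f j = 0 → ∀ j, (2 : ℤ) ^ k ∣ b j) ∧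
      (∀ (a : Fin rp → ℤ) (b : Fin rm → ℤ), ∑ i, a i • e i + ∑ j, b j • f j = 0 →
        (∀ i, (2 : ℤ) ^ (k - 1) ∣ a i) ∧ (∀ j, (2 : ℤ) ^ (k - 1) ∣ b j)) ∧
      (∀ c ∈ C, (2 : ℤ) ^ k • c = 0 →
        ∃ (a : Fin rp → ℤ) (b : Fin rm → ℤ), (2 : ℤ) • c = ∑ i, a i • e i + ∑ j, b j • f j) := by
  classical
  set Bp : AddSubgroup A := C.map (AddMonoidHom.id A + τ) with hBp
  set Bm : AddSubgroup A := C.map (AddMonoidHom.id A - τ) with hBm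
  haveI : Finite ↥(Bp ⊓ torsionBy A ((2 : ℕ) : ℤ)) :=
    Finite.of_injective (inclusion (inf_le_right : Bp ⊓ torsionBy A ((2 : ℕ) : ℤ) ≤ _)) (inclusion_injective _)
  haveI : Finite ↥(Bm ⊓ torsionBy A ((2 : ℕ) : ℤ)) :=
    Finite.of_injective (inclusion (inf_le_right : Bm ⊓ torsionBy A ((2 : ℕ) : ℤ) ≤ _)) (inclusion_injective _)
  obtain ⟨rp, p, hpcard, hpB, hp2, hpI, hpS⟩ := exists_bot_basis Bp
  obtain ⟨rm, m, hmcard, hmB, hm2, hmI, hmS⟩ := exists_bot_basis Bm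
  refine ⟨rp, rm, hpcard, hmcard, fun k hk ↦ ?_⟩
  exact eigenframe_of_divisible τ hτ C hC hdiv p (fun i ↦ (mem_map_id_add τ C _).1 (hpB i)) hp2 hpI
    (fun t ht h2 ↦ hpS t ((mem_map_id_add τ C t).2 ht) h2) m (fun j ↦ (mem_map_id_sub τ C _).1 (hmB j))
    hm2 hmI (fun t ht h2 ↦ hmS t ((mem_map_id_sub τ C t).2 ht) h2) k hk

end Finite

end Summit.BirchSwinnertonDyer.BirchSwinnertonDyer.Theorems.KolyvaginAtTwo.EigenframeFinite
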